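import Literature.NumberTheory.EllipticCurves.Tamagawa
import Literature.NumberTheory.EllipticCurves.VariableChangePoints
import Literature.NumberTheory.DiophantineGeometry.MinimalModelUniquenessProofs
import HarnessLib

/-!
# Isomorphism invariance of the Tamagawa numbers — discharged facts of `Tamagawa.lean`

Sibling proof file of `Literature.NumberTheory.EllipticCurves.Tamagawa` (D-0014: the facts there
are named `def X : Prop`; discharges `theorem X_holds : X` live here). Source: J. H. Silverman,
*The Arithmetic of Elliptic Curves*, 2nd ed. (2009):

* **Prop. VII.1.3(b)** (PDF p. 165): a minimal Weierstrass equation over the fraction field `K`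
  of a discrete valuation ring `R` is unique up to a change of coordinates `x = u²x' + r`,
  `y = u³y' + u²sx' + t` with `u ∈ R*`, `r, s, t ∈ R` — in the tree as
  `WeierstrassCurve.exists_variableChange_integralModel_eq` (`MinimalModelUniquenessProofs`);
* **VII.2** (PDF p. 166): such a change of coordinates reduces to the standard change of
  coordinates `(ū, r̄, s̄, t̄)` of the reduced equations over the residue field, so the reduction
  map `E(K) → Ẽ(k)` commutes with the induced isomorphisms of point sets, and the set
  `E₀(K)` of points with nonsingular reduction (defined before Prop. VII.2.1) corresponds;
* **VII.6, Ex. 7.6 / App. C §16** (PDF p. 392): `c_v = #E(K_v)/E₀(K_v)` is attached to `E/K_v`.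

## Contents

* `WeierstrassCurve.isNonsingularReductionPoint_pointEquiv_iff`: for an `R`-integral change of
  variables `D'` between minimal equations (relating the integral models), a point `P` has
  nonsingular reduction iff its image under `VariableChange.pointEquiv` has.
* `WeierstrassCurve.index_goodReductionSubgroup_eq_of_eq_smul`: two `K`-isomorphic minimal
  equations of an elliptic curve have the same index `[E(K) : E₀(K)]`.
* `WeierstrassCurve.localTamagawaNumber_variableChange_holds`: discharge of the named fact
  `localTamagawaNumber_variableChange` (`c(C • W) = c(W)` for elliptic `W`).
* `WeierstrassCurve.tamagawaProduct_variableChange_eq`: over a number field,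
  `∏ᶠ v, c_v (C • W) = ∏ᶠ v, c_v (W)` (place by place, `(C • W)_v = C_v • W_v`).

## References

* [SilvermanAEC2009] J. H. Silverman, *The Arithmetic of Elliptic Curves*, GTM 106, 2nd ed. 2009,
  Prop. VII.1.3(b) (PDF p. 165), §VII.2 (PDF p. 166), §VII.6 and Ex. 7.6, Conj. C.16.5 (PDF p. 392).
-/

noncomputable section

open scoped Classical

namespace WeierstrassCurve

namespace VariableChange

variable {R S : Type*} [CommRing R] [CommRing S] (f : R →+* S) (C : VariableChange R)

/-- The new `x`-coordinate commutes with ring homomorphisms (`toX` is a polynomial in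
`u⁻¹, r, x`). [folklore] -/
theorem ringHom_toX (x : R) : f (C.toX x) = (C.map f).toX (f x) := by
  simp only [toX_def, VariableChange.map, Units.coe_map_inv, MonoidHom.coe_coe, map_mul, map_pow,
    map_sub]

/-- The new `y`-coordinate commutes with ring homomorphisms. [folklore] -/
theorem ringHom_toY (x y : R) : f (C.toY x y) = (C.map f).toY (f x) (f y) := by
  simp only [toY_def, VariableChange.map, Units.coe_map_inv, MonoidHom.coe_coe, map_mul, map_pow,
    map_sub]

/-- The old `x`-coordinate commutes with ring homomorphisms. [folklore] -/
theorem ringHom_ofX (x' : R) : f (C.ofX x') = (C.map f).ofX (f x') := by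
  simp only [ofX_def, VariableChange.map, Units.coe_map, MonoidHom.coe_coe, map_mul, map_pow,
    map_add]

/-- The old `y`-coordinate commutes with ring homomorphisms. [folklore] -/
theorem ringHom_ofY (x' y' : R) : f (C.ofY x' y') = (C.map f).ofY (f x') (f y') := by
  simp only [ofY_def, VariableChange.map, Units.coe_map, MonoidHom.coe_coe, map_mul, map_pow,
    map_add]

end VariableChange

section Local

variable (R : Type*) [CommRing R] [IsDomain R] [IsDiscreteValuationRing R] {K : Type*}
  [Field K] [Algebra R K] [IsFractionRing R K]

open IsLocalRing

/-- **Reduction commutes with `R`-integral changes of variables** (Silverman, *AEC*, VII.2,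
PDF p. 166). Let `W` and `D • W` be minimal Weierstrass equations over `K` with `D` the image of
a change of variables `D'` over `R` relating their integral models. Then a point `P ∈ W(K)` has
nonsingular reduction iff its image `(u⁻²(x − r), u⁻³(y − s(x − r) − t))` on `D • W` has:
integrality of the `x`-coordinate is preserved (`u ∈ R*`, `r ∈ R`), and on integral points the
reduced coordinates are related by the reduced change of variables `D̄'`, which preserves
nonsingularity (`VariableChange.nonsingular_iff`). [cite: SilvermanAEC2009, VII.2 (PDF p. 166)] -/
theorem isNonsingularReductionPoint_pointEquiv_iff {W : WeierstrassCurve K} [IsMinimal R W]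
    (D' : VariableChange R) [IsMinimal R (D'.map (algebraMap R K) • W)]
    (hI : integralModel R (D'.map (algebraMap R K) • W) = D' • integralModel R W)
    (P : W.toAffine.Point) :
    (D'.map (algebraMap R K) • W).IsNonsingularReductionPoint R
        (VariableChange.pointEquiv W (D'.map (algebraMap R K)) P) ↔
      W.IsNonsingularReductionPoint R P := by
  have hred : (D'.map (algebraMap R K) • W).reduction R = D'.map (residue R) • W.reduction R := by
    rw [reduction, reduction, hI, map_variableChange]
  rcases P with _ | ⟨x, y, hxy⟩
  · rw [← Affine.Point.zero_def, map_zero]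
    simp
  rw [VariableChange.pointEquiv_some]
  simp only [IsNonsingularReductionPoint]
  refine or_congr (not_congr ⟨?_, ?_⟩) ⟨?_, ?_⟩
  · rintro ⟨x₀', hx₀'⟩
    refine ⟨D'.ofX x₀', ?_⟩
    rw [VariableChange.ringHom_ofX, hx₀', VariableChange.ofX_toX]
  · rintro ⟨x₀, rfl⟩
    exact ⟨D'.toX x₀, VariableChange.ringHom_toX _ _ _⟩
  · rintro ⟨x₀', y₀', hx, hy, hns⟩
    refine ⟨D'.ofX x₀', D'.ofY x₀' y₀', ?_, ?_, ?_⟩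
    · rw [VariableChange.ringHom_ofX, hx, VariableChange.ofX_toX]
    · rw [VariableChange.ringHom_ofY, hx, hy, VariableChange.ofY_toY]
    · rw [VariableChange.ringHom_ofX, VariableChange.ringHom_ofY, VariableChange.nonsingular_ofXY_iff,
        ← hred]
      exact hns
  · rintro ⟨x₀, y₀, rfl, rfl, hns⟩
    refine ⟨D'.toX x₀, D'.toY x₀ y₀, VariableChange.ringHom_toX _ _ _,
      VariableChange.ringHom_toY _ _ _ _, ?_⟩
    rw [VariableChange.ringHom_toX, VariableChange.ringHom_toY, hred,
      VariableChange.nonsingular_iff]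
    exact hns

/-- **`[E(K) : E₀(K)]` is the same for two `K`-isomorphic minimal equations of an elliptic curve**
(Silverman, *AEC*, VII.1.3(b) with VII.2 and VII.6, Ex. 7.6): the isomorphism of point groups
`VariableChange.pointEquiv` maps the points with nonsingular reduction of `W₁` onto those of
`W₂ = D • W₁` (`isNonsingularReductionPoint_pointEquiv_iff`, `D` being `R`-integral by
VII.1.3(b)), hence `E₀` onto `E₀`, and the index is invariant under isomorphisms.
[cite: SilvermanAEC2009, VII.1 Prop. 1.3(b) (PDF p. 165) and VII.2 (PDF p. 166)] -/
theorem index_goodReductionSubgroup_eq_of_eq_smul {W₁ W₂ : WeierstrassCurve K} [IsMinimal R W₁]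
    [IsMinimal R W₂] {D : VariableChange K} (h : W₂ = D • W₁) (hΔ : W₁.Δ ≠ 0) :
    (W₂.goodReductionSubgroup R).index = (W₁.goodReductionSubgroup R).index := by
  obtain ⟨D', hD', hI⟩ := exists_variableChange_integralModel_eq R h hΔ
  subst h
  subst hD'
  set e := VariableChange.pointEquiv W₁ (D'.map (algebraMap R K)) with he
  have hset : {P | (D'.map (algebraMap R K) • W₁).IsNonsingularReductionPoint R P} =
      e.toAddMonoidHom '' {P | W₁.IsNonsingularReductionPoint R P} := by
    ext Q
    constructor
    · intro hQ
      refine ⟨e.symm Q, ?_, e.apply_symm_apply Q⟩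
      rw [Set.mem_setOf_eq, ← isNonsingularReductionPoint_pointEquiv_iff R D' hI, ← he,
        e.apply_symm_apply]
      exact hQ
    · rintro ⟨P, hP, rfl⟩
      exact (isNonsingularReductionPoint_pointEquiv_iff R D' hI P).mpr hP
  rw [goodReductionSubgroup, goodReductionSubgroup, hset, ← AddMonoidHom.map_closure]
  exact AddSubgroup.index_map_equiv _ e

/-- **Silverman, *AEC* VII.6, Ex. 7.6 with Prop. VII.1.3(b)**: the local Tamagawa number
`c(W/K) = [E(K) : E₀(K)]` of an elliptic curve over the fraction field of a discrete valuation
ring does not depend on the Weierstrass equation. Discharge of the named fact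
`localTamagawaNumber_variableChange`: the chosen minimal models of `W` and `C • W` are
`K`-isomorphic minimal equations of an elliptic curve (`index_goodReductionSubgroup_eq_of_eq_smul`).
[cite: SilvermanAEC2009, VII.1 Prop. 1.3(b) (PDF p. 165) and VII.6 Ex. 7.6] -/
theorem localTamagawaNumber_variableChange_holds (W : WeierstrassCurve K) :
    localTamagawaNumber_variableChange R W := by
  intro hE C
  obtain ⟨D, hD⟩ : ∃ D : VariableChange K, (C • W).minimal R = D • W.minimal R :=
    ⟨((C • W).exists_isMinimal R).choose * C * ((W.exists_isMinimal R).choose)⁻¹, by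
      rw [minimal, minimal, mul_smul, mul_smul, inv_smul_smul]⟩
  haveI : (W.minimal R).IsElliptic := by rw [minimal]; infer_instance
  unfold localTamagawaNumber
  exact index_goodReductionSubgroup_eq_of_eq_smul R hD (W.minimal R).isUnit_Δ.ne_zero

end Local

section NumberField

open IsDedekindDomain NumberField

variable {K : Type*} [Field K] [NumberField K] (W : WeierstrassCurve K) (C : VariableChange K)

/-- **The Tamagawa product is an isomorphism invariant** of an elliptic curve over a number field
(Silverman, *AEC*, Conj. C.16.5, PDF p. 392: `c_p = #E(ℚ_p)/E₀(ℚ_p)` is attached to `E`; VII.6,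
Ex. 7.6 with Prop. VII.1.3(b)): `∏ᶠ v, c_v(C • W) = ∏ᶠ v, c_v(W)`, place by place from
`localTamagawaNumber_variableChange_holds` applied to `W / K_v` and `C / K_v`
(`(C • W)_v = C_v • W_v`, Mathlib `map_variableChange`). This is the named fact
`WeierstrassCurve.tamagawaProduct_variableChange` of `BSDInvariants.lean`, restated here to keep
the import graph of this file below `BSDInvariants`.
[cite: SilvermanAEC2009, Conj. C.16.5 (PDF p. 392) with VII.1 Prop. 1.3(b)] -/
theorem tamagawaProduct_variableChange_eq [W.IsElliptic] :
    (C • W).tamagawaProduct = W.tamagawaProduct := by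
  unfold tamagawaProduct
  refine finprod_congr fun v => ?_
  simp only [baseChange, ← map_variableChange]
  exact localTamagawaNumber_variableChange_holds (v.adicCompletionIntegers K)
    (W.map (algebraMap K (v.adicCompletion K))) (C.map (algebraMap K (v.adicCompletion K)))

end NumberField

end WeierstrassCurve

end
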